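import Literature.MathematicalPhysics.QuantumFieldTheory.WilsonFinTorusTwistTensor
import Literature.MathematicalPhysics.QuantumFieldTheory.WilsonFinTorusElectricFluxSectors
import HarnessLib

/-!
# 't Hooft's exact duality equation (6.3) on the anisotropic lattice four-torus

Topic `Literature/MathematicalPhysics/QuantumFieldTheory`; sequel of `WilsonFinTorusTwistTensor.lean` (the twisted Wilson
integral `W{n_{μν}; a_μ} = wilsonFinTorusTensorTwistedPartition ρ β z n₀ n₁ n₂ n₃` with all six twists and its covariance
`wilsonFinTorusTensorTwistedPartition_rotate` under 't Hooft's axis exchange (6.1)) and of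
`WilsonFinTorusElectricFluxSectors.lean` ∕ `Literature/Analysis/OperatorTheory/TwistedKernelFluxSectors.lean` (character
bookkeeping on a finite abelian group: `sum_apply_mul_fluxProjection_eq`, Fourier inversion of the flux projections).

G. 't Hooft, Nucl. Phys. B 153 (1979) 141, §5 (5.4) «e^{−βF(e,m;a,β)} = N⁻³ Σ_k e^{−2πi(k·e)/N} W{k, m; a_μ}» and §6:
«(6.2) W{k̃, k₃, m̃, m₃; ã, a₃, β} = W{m̃, k₃, k̃, m₃; â, β, a₃}.  The consequence of this is
(6.3) exp{−βF(ẽ, e₃, m̃, m₃; ã, a₃, β)} = N⁻² Σ_{k̃,l̃} exp{(2πi/N)[−(k̃·ẽ) + (l̃·m̃)] − a₃F(l̃, e₃, k̃, m₃; â, β, a₃)}.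
Here N⁻² normalizes the Fourier transforms … It must be stressed that so far no approximation has been made.  Our duality
equation (6.3) for pure non-Abelian gauge theories is exact.» (reprint C. Rebbi (ed.) 1983, p. 554).

Here, on the `Fin`-box `a × b × c × d` (axis `3` = Euclidean time, axis `2` = 't Hooft's longitudinal direction «3», axes
`0, 1` = his transverse directions `1, 2`), for every compact `G`, continuous `ρ`, real `β`, every finite abelian group `Γ`
(additive) of twist labels with a map `φ : Γ → G`, `φ 0 = 1`, `φ (k + k') = φ k · φ k'` ('t Hooft: `Γ = ℤ_N → Z(SU(N))`),
flux labels = characters `ψ ∈ AddChar Γ ℂ` (Mathlib's additive notation: `0` the trivial character, `−ψ = conj ψ`):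

* `twistIdx k₀ k₁ k₂ m₁₂ m₀₂ m₀₁ : Fin 4 → Fin 4 → Γ` — the twist tensor with electric (temporal) entries `k₀, k₁, k₂` in the
  planes `(0,3), (1,3), (2,3)` and magnetic entries `m₁₂, m₀₂, m₀₁` in `(1,2), (0,2), (0,1)`;
* `wilsonFinTorusFluxTransform ρ β φ ψ₀ ψ₁ ψ₂ m₁₂ m₀₂ m₀₁ a b c d` — 't Hooft's `e^{−βF(e, m; a, β)}`, eq. (5.4) WITH magnetic
  flux: the triple `Γ`-Fourier transform of `k ↦ W{φ ∘ twistIdx k m}(a,b,c,d)` over the three electric twists (written as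
  three nested one-variable transforms `|Γ|⁻¹ Σ_k conj ψ(k) ·`), at fixed magnetic twists;
* `rotateTwistTensor_twistIdx` — the axis exchange (6.1) on `Γ`-tensors: `(k₀,k₁,k₂ | m₁₂,m₀₂,m₀₁) ↦ (m₁₂,m₀₂,−k₂ | k₀,k₁,−m₀₁)`;
  `wilsonFinTorusTensorTwistedPartition_rotate_twistIdx` — (6.2) in these labels;
* ★ `wilsonFinTorusFluxTransform_duality` — **THE DUALITY EQUATION (6.3)**:
  `e^{−F}(ψ₀,ψ₁,ψ₂ | m₁₂,m₀₂,m₀₁; a,b,c,d) = |Γ|⁻² Σ_{k₀,k₁} conj ψ₀(k₀) conj ψ₁(k₁) Σ_{χ₀,χ₁} χ₀(m₁₂) χ₁(m₀₂) ·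
  e^{−F}(χ₀,χ₁,−ψ₂ | k₀,k₁,−m₀₁; b,a,d,c)` — the transverse electric fluxes `(ψ₀,ψ₁) = ẽ` are Fourier-transformed into
  transverse magnetic twists `k̃` of the exchanged box, the transverse magnetic twists `m̃ = (m₁₂,m₀₂)` into transverse
  electric fluxes `l̃ = (χ₀,χ₁)`: «Right- and left-hand side of eq. (6.3) differ by a Fourier transformation and dual
  interchange with respect to only ẽ and m̃».  The longitudinal labels appear inverted (`e₃ ↦ −ψ₂`, `m₃ ↦ −m₀₁`): the printed
  (6.3) keeps them, 't Hooft's rotation (6.1) containing two coordinate reflections; for the case he uses (`e₃ = m₃ = 0`,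
  §7.3 ∕ (7.6)) and for `ℤ₂` labels the statements coincide literally (`wilsonFinTorusFluxTransform_duality_longitudinal_zero`).

Everything is PROVED; two definitions with bodies; no named fact.  HONEST FRAMING: an exact identity between finite-box
integrals at every `β` — as 't Hooft stresses, no approximation and no content about which fluxes are light or heavy (§7),
the string tension (7.3), infinite volume or a mass gap.

References: 't Hooft 1979 §5 (5.4), §6 (6.1)–(6.3), §7.3 (7.6); J. Greensite, *An Introduction to the Confinement Problem*
(2011) §4.4 (4.41)–(4.44); J.-P. Serre, *Linear Representations of Finite Groups* (1977) §2.6 Thm 8 (character orthogonality).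
-/

noncomputable section

open scoped BigOperators ComplexConjugate
open MeasureTheory Finset
open Literature.Analysis.OperatorTheory

namespace Literature.MathematicalPhysics.QuantumFieldTheory

/-! ### Twist tensors with entries in the label group and their axis exchange -/

section Labels

variable {Γ : Type*} [AddCommGroup Γ]

/-- **The twist tensor from its six labels**: electric (temporal) twists `k₀, k₁, k₂` in the planes `(0,3), (1,3), (2,3)`,
magnetic twists `m₁₂, m₀₂, m₀₁` in the planes `(1,2), (0,2), (0,1)` ('t Hooft's `n_{4i} = k_i`, `n_{ij} = ε_{ijk} m_k`; entries
`μ ≥ ν` are placeholders `0`). [cite: tHooft1979Flux, §2 (2.5)] -/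
def twistIdx (k₀ k₁ k₂ m₁₂ m₀₂ m₀₁ : Γ) : Fin 4 → Fin 4 → Γ :=
  ![![0, m₀₁, m₀₂, k₀], ![0, 0, m₁₂, k₁], ![0, 0, 0, k₂], ![0, 0, 0, 0]]

/-- **'t Hooft's axis exchange (6.1) on the labels**: the rotated tensor of `φ ∘ twistIdx (k₀,k₁,k₂ | m₁₂,m₀₂,m₀₁)` is
`φ ∘ twistIdx (m₁₂,m₀₂,−k₂ | k₀,k₁,−m₀₁)` — transverse electric and magnetic labels exchanged, longitudinal ones negated —
for any `φ : Γ → G` with `φ 0 = 1` and `φ (−k) = (φ k)⁻¹`. [cite: tHooft1979Flux, §6 (6.1)–(6.2)] -/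
theorem rotateTwistTensor_twistIdx {G : Type*} [Group G] (φ : Γ → G) (hφ0 : φ 0 = 1)
    (hφneg : ∀ k, φ (-k) = (φ k)⁻¹) (k₀ k₁ k₂ m₁₂ m₀₂ m₀₁ : Γ) :
    rotateTwistTensor (fun μ ν => φ (twistIdx k₀ k₁ k₂ m₁₂ m₀₂ m₀₁ μ ν)) =
      fun μ ν => φ (twistIdx m₁₂ m₀₂ (-k₂) k₀ k₁ (-m₀₁) μ ν) := by
  funext μ ν
  fin_cases μ <;> fin_cases ν <;> simp [rotateTwistTensor, twistIdx, hφ0, hφneg]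

end Labels

/-! ### The electric-flux transform at fixed magnetic twists -/

section Flux

variable {G : Type*} [Group G] [TopologicalSpace G] [IsTopologicalGroup G] [CompactSpace G]
  [MeasurableSpace G] [BorelSpace G] {N : ℕ} (ρ : G →* Matrix (Fin N) (Fin N) ℂ)
  {Γ : Type*} [AddCommGroup Γ] [Fintype Γ]

/-- **'t Hooft's flux free energy `e^{−βF(e, m; a, β)}` with magnetic flux** — eq. (5.4): the `Γ`-Fourier transform over
the three electric (temporal) twists `k₀, k₁, k₂` of the twisted integral `W{φ ∘ twistIdx (k | m)}(a,b,c,d)`, with the flux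
characters `ψ₀, ψ₁, ψ₂` ('t Hooft's `e^{−2πi(k·e)/N}`, transverse `ẽ = (ψ₀, ψ₁)`, longitudinal `e₃ = ψ₂`) at fixed magnetic
twists `m₁₂, m₀₂, m₀₁`; written as three nested one-variable transforms `|Γ|⁻¹ Σ_k conj ψ(k) · (…)`.
[cite: tHooft1979Flux, §5 (5.4)] [cite: Greensite2011, §4.4 (4.44)] -/
def wilsonFinTorusFluxTransform (β : ℝ) (φ : Γ → G) (ψ₀ ψ₁ ψ₂ : AddChar Γ ℂ) (m₁₂ m₀₂ m₀₁ : Γ)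
    (a b c d : ℕ) : ℂ :=
  (Fintype.card Γ : ℂ)⁻¹ * ∑ k₀, conj (ψ₀ k₀) *
    ((Fintype.card Γ : ℂ)⁻¹ * ∑ k₁, conj (ψ₁ k₁) *
      ((Fintype.card Γ : ℂ)⁻¹ * ∑ k₂, conj (ψ₂ k₂) *
        (wilsonFinTorusTensorTwistedPartition ρ β (fun μ ν => φ (twistIdx k₀ k₁ k₂ m₁₂ m₀₂ m₀₁ μ ν)) a b c d : ℂ)))

/-- Unfolding lemma. [cite: tHooft1979Flux, §5 (5.4)] -/
theorem wilsonFinTorusFluxTransform_def (β : ℝ) (φ : Γ → G) (ψ₀ ψ₁ ψ₂ : AddChar Γ ℂ) (m₁₂ m₀₂ m₀₁ : Γ)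
    (a b c d : ℕ) :
    wilsonFinTorusFluxTransform ρ β φ ψ₀ ψ₁ ψ₂ m₁₂ m₀₂ m₀₁ a b c d =
      (Fintype.card Γ : ℂ)⁻¹ * ∑ k₀, conj (ψ₀ k₀) *
        ((Fintype.card Γ : ℂ)⁻¹ * ∑ k₁, conj (ψ₁ k₁) *
          ((Fintype.card Γ : ℂ)⁻¹ * ∑ k₂, conj (ψ₂ k₂) *
            (wilsonFinTorusTensorTwistedPartition ρ β
              (fun μ ν => φ (twistIdx k₀ k₁ k₂ m₁₂ m₀₂ m₀₁ μ ν)) a b c d : ℂ))) := rfl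

omit [Fintype Γ] in
/-- **(6.2) in the labels**: `W{φ∘(k₀,k₁,k₂ | m₁₂,m₀₂,m₀₁)}(a,b,c,d) = W{φ∘(m₁₂,m₀₂,−k₂ | k₀,k₁,−m₀₁)}(b,a,d,c)` for a twist map
`φ` with `φ 0 = 1`, `φ(k+k') = φ k φ k'` (continuous `ρ`, compact `G`, real `β`).
[cite: tHooft1979Flux, §6 (6.1)–(6.2)] -/
theorem wilsonFinTorusTensorTwistedPartition_rotate_twistIdx (hρ : Continuous ρ) (β : ℝ) {φ : Γ → G} (hφ0 : φ 0 = 1)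
    (hφadd : ∀ k k', φ (k + k') = φ k * φ k') (k₀ k₁ k₂ m₁₂ m₀₂ m₀₁ : Γ) (a b c d : ℕ) :
    wilsonFinTorusTensorTwistedPartition ρ β (fun μ ν => φ (twistIdx k₀ k₁ k₂ m₁₂ m₀₂ m₀₁ μ ν)) a b c d =
      wilsonFinTorusTensorTwistedPartition ρ β (fun μ ν => φ (twistIdx m₁₂ m₀₂ (-k₂) k₀ k₁ (-m₀₁) μ ν)) b a d c := by
  have hφneg : ∀ k, φ (-k) = (φ k)⁻¹ := fun k =>
    eq_inv_of_mul_eq_one_left (by rw [← hφadd, neg_add_cancel, hφ0])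
  rw [wilsonFinTorusTensorTwistedPartition_rotate ρ hρ β, rotateTwistTensor_twistIdx φ hφ0 hφneg]

/-- Reflection in the longitudinal electric twist: `|Γ|⁻¹ Σ_k conj ψ(k) g(−k) = |Γ|⁻¹ Σ_k conj ((−ψ) k) g(k)`
(reindex `k ↦ −k`; `(−ψ)(k) = ψ(−k)`). [cite: Serre1977, §2.6 Thm 8 (ii)] -/
theorem sum_conj_apply_mul_comp_neg (ψ : AddChar Γ ℂ) (g : Γ → ℂ) :
    (Fintype.card Γ : ℂ)⁻¹ * ∑ k, conj (ψ k) * g (-k) = (Fintype.card Γ : ℂ)⁻¹ * ∑ k, conj ((-ψ) k) * g k := by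
  congr 1
  simp_rw [AddChar.neg_apply]
  exact Fintype.sum_equiv (Equiv.neg Γ) _ _ fun k => by simp

/-- **Two-variable Fourier inversion in the nested form**:
`Σ_{χ₀} χ₀(t₀) Σ_{χ₁} χ₁(t₁) · |Γ|⁻¹ Σ_{s₀} conj χ₀(s₀) · |Γ|⁻¹ Σ_{s₁} conj χ₁(s₁) · H(s₀, s₁) = H(t₀, t₁)`.
[cite: Serre1977, §2.3 Thm 3 and §2.6 Thm 8 (ii)] -/
theorem sum_sum_apply_mul_fluxProjection₂_eq (H : Γ → Γ → ℂ) (t₀ t₁ : Γ) :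
    ∑ χ₀ : AddChar Γ ℂ, χ₀ t₀ * ∑ χ₁ : AddChar Γ ℂ, χ₁ t₁ *
      ((Fintype.card Γ : ℂ)⁻¹ * ∑ s₀, conj (χ₀ s₀) * ((Fintype.card Γ : ℂ)⁻¹ * ∑ s₁, conj (χ₁ s₁) * H s₀ s₁)) =
      H t₀ t₁ := by
  -- swap the `χ₁`-sum inside the `s₀`-sum and invert in `χ₁`, then in `χ₀`
  have hinner : ∀ χ₀ : AddChar Γ ℂ, ∑ χ₁ : AddChar Γ ℂ, χ₁ t₁ *
      ((Fintype.card Γ : ℂ)⁻¹ * ∑ s₀, conj (χ₀ s₀) * ((Fintype.card Γ : ℂ)⁻¹ * ∑ s₁, conj (χ₁ s₁) * H s₀ s₁)) =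
      (Fintype.card Γ : ℂ)⁻¹ * ∑ s₀, conj (χ₀ s₀) * H s₀ t₁ := by
    intro χ₀
    calc ∑ χ₁ : AddChar Γ ℂ, χ₁ t₁ *
          ((Fintype.card Γ : ℂ)⁻¹ * ∑ s₀, conj (χ₀ s₀) * ((Fintype.card Γ : ℂ)⁻¹ * ∑ s₁, conj (χ₁ s₁) * H s₀ s₁))
        = (Fintype.card Γ : ℂ)⁻¹ * ∑ s₀, conj (χ₀ s₀) *
            ∑ χ₁ : AddChar Γ ℂ, χ₁ t₁ * ((Fintype.card Γ : ℂ)⁻¹ * ∑ s₁, conj (χ₁ s₁) * H s₀ s₁) := by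
          simp_rw [Finset.mul_sum]
          rw [Finset.sum_comm]
          refine Finset.sum_congr rfl fun s₀ _ => Finset.sum_congr rfl fun χ₁ _ => ?_
          ring_nf
      _ = (Fintype.card Γ : ℂ)⁻¹ * ∑ s₀, conj (χ₀ s₀) * H s₀ t₁ := by
          congr 1
          refine Finset.sum_congr rfl fun s₀ _ => ?_
          rw [sum_apply_mul_fluxProjection_eq (fun s₁ => H s₀ s₁) t₁]
  simp_rw [hinner]
  exact sum_apply_mul_fluxProjection_eq (fun s₀ => H s₀ t₁) t₀

/-- ★ **'t Hooft's exact duality equation (6.3) on the anisotropic lattice box.**  For every compact `G`, continuous `ρ`,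
real `β`, finite abelian label group `Γ` with `φ 0 = 1`, `φ (k + k') = φ k · φ k'`, all flux characters `ψ₀, ψ₁, ψ₂`, all
magnetic twists `m₁₂, m₀₂, m₀₁` and all sides:
`e^{−F}(ψ₀,ψ₁,ψ₂ | m₁₂,m₀₂,m₀₁; a,b,c,d) = |Γ|⁻² Σ_{k₀,k₁} conj ψ₀(k₀) conj ψ₁(k₁) Σ_{χ₀,χ₁} χ₀(m₁₂) χ₁(m₀₂) ·
e^{−F}(χ₀,χ₁,−ψ₂ | k₀,k₁,−m₀₁; b,a,d,c)` — «right- and left-hand side differ by a Fourier transformation and dual interchange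
with respect to only ẽ and m̃ … exact» (the longitudinal labels inverted; see the module docstring).  Proof: (6.2) for every
summand, Fourier inversion of the exchanged box's transform in its two transverse electric twists, and the reflection
`k₂ ↦ −k₂`. [cite: tHooft1979Flux, §6 (6.2)–(6.3)] [cite: Serre1977, §2.6 Thm 8 (ii)] -/
theorem wilsonFinTorusFluxTransform_duality (hρ : Continuous ρ) (β : ℝ) {φ : Γ → G} (hφ0 : φ 0 = 1)
    (hφadd : ∀ k k', φ (k + k') = φ k * φ k') (ψ₀ ψ₁ ψ₂ : AddChar Γ ℂ) (m₁₂ m₀₂ m₀₁ : Γ) (a b c d : ℕ) :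
    wilsonFinTorusFluxTransform ρ β φ ψ₀ ψ₁ ψ₂ m₁₂ m₀₂ m₀₁ a b c d =
      (Fintype.card Γ : ℂ)⁻¹ * ∑ k₀, conj (ψ₀ k₀) *
        ((Fintype.card Γ : ℂ)⁻¹ * ∑ k₁, conj (ψ₁ k₁) *
          ∑ χ₀ : AddChar Γ ℂ, χ₀ m₁₂ * ∑ χ₁ : AddChar Γ ℂ, χ₁ m₀₂ *
            wilsonFinTorusFluxTransform ρ β φ χ₀ χ₁ (-ψ₂) k₀ k₁ (-m₀₁) b a d c) := by
  simp only [wilsonFinTorusFluxTransform_def]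
  refine congrArg _ (Finset.sum_congr rfl fun k₀ _ => congrArg _ (congrArg _ (Finset.sum_congr rfl fun k₁ _ =>
    congrArg _ ?_)))
  -- for fixed `k₀, k₁`: the inner transform, after (6.2) and the reflection `k₂ ↦ −k₂`, is the two-variable inverse
  -- Fourier transform of the exchanged box's flux transform evaluated at the magnetic twists `(m₁₂, m₀₂)`
  rw [sum_sum_apply_mul_fluxProjection₂_eq (fun s₀ s₁ => (Fintype.card Γ : ℂ)⁻¹ * ∑ k₂, conj ((-ψ₂) k₂) *
    (wilsonFinTorusTensorTwistedPartition ρ β (fun μ ν => φ (twistIdx s₀ s₁ k₂ k₀ k₁ (-m₀₁) μ ν)) b a d c : ℂ)) m₁₂ m₀₂]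
  rw [← sum_conj_apply_mul_comp_neg ψ₂ fun k₂ =>
    (wilsonFinTorusTensorTwistedPartition ρ β (fun μ ν => φ (twistIdx m₁₂ m₀₂ k₂ k₀ k₁ (-m₀₁) μ ν)) b a d c : ℂ)]
  congr 1
  refine Finset.sum_congr rfl fun k₂ _ => ?_
  rw [wilsonFinTorusTensorTwistedPartition_rotate_twistIdx ρ hρ β hφ0 hφadd]

/-- **The case 't Hooft uses (`e₃ = m₃ = 0`, §7.3 (7.6)): literal (6.3).**  With trivial longitudinal labels
(`ψ₂ = 0`, `m₀₁ = 0`) no inversion remains: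
`e^{−F}(ψ₀,ψ₁,0 | m₁₂,m₀₂,0; a,b,c,d) = |Γ|⁻² Σ_{k₀,k₁} conj ψ₀(k₀) conj ψ₁(k₁) Σ_{χ₀,χ₁} χ₀(m₁₂) χ₁(m₀₂) e^{−F}(χ₀,χ₁,0 | k₀,k₁,0; b,a,d,c)`.
[cite: tHooft1979Flux, §6 (6.3) and §7.3 (7.6)] -/
theorem wilsonFinTorusFluxTransform_duality_longitudinal_zero (hρ : Continuous ρ) (β : ℝ) {φ : Γ → G} (hφ0 : φ 0 = 1)
    (hφadd : ∀ k k', φ (k + k') = φ k * φ k') (ψ₀ ψ₁ : AddChar Γ ℂ) (m₁₂ m₀₂ : Γ) (a b c d : ℕ) :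
    wilsonFinTorusFluxTransform ρ β φ ψ₀ ψ₁ 0 m₁₂ m₀₂ 0 a b c d =
      (Fintype.card Γ : ℂ)⁻¹ * ∑ k₀, conj (ψ₀ k₀) *
        ((Fintype.card Γ : ℂ)⁻¹ * ∑ k₁, conj (ψ₁ k₁) *
          ∑ χ₀ : AddChar Γ ℂ, χ₀ m₁₂ * ∑ χ₁ : AddChar Γ ℂ, χ₁ m₀₂ *
            wilsonFinTorusFluxTransform ρ β φ χ₀ χ₁ 0 k₀ k₁ 0 b a d c) := by
  have h := wilsonFinTorusFluxTransform_duality ρ hρ β hφ0 hφadd ψ₀ ψ₁ 0 m₁₂ m₀₂ 0 a b c d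
  rwa [neg_zero, neg_zero] at h

omit [Fintype Γ] in
/-- **No twist at all is Wilson's partition function**: the tensor of zero labels gives `Z(a,b,c,d)`.
[cite: tHooft1979Flux, §2 (2.6)] -/
theorem wilsonFinTorusTensorTwistedPartition_twistIdx_zero (β : ℝ) {φ : Γ → G} (hφ0 : φ 0 = 1) (a b c d : ℕ) :
    wilsonFinTorusTensorTwistedPartition ρ β (fun μ ν => φ (twistIdx (0 : Γ) 0 0 0 0 0 μ ν)) a b c d =
      wilsonFinTorusPartition ρ β a b c d := by
  have h0 : (fun μ ν : Fin 4 => φ (twistIdx (0 : Γ) 0 0 0 0 0 μ ν)) = temporalTwistTensor (1 : Fin 4 → G) := by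
    funext μ ν
    fin_cases μ <;> fin_cases ν <;> simp [twistIdx, temporalTwistTensor, hφ0]
  rw [h0, wilsonFinTorusTensorTwistedPartition_temporal, wilsonFinTorusTwistedPartition_one]

end Flux

end Literature.MathematicalPhysics.QuantumFieldTheory

end
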